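import Summits.QuantumFields.YangMills.Theorems.PoincareLipschitzCovariantCaccioppoli
import Summits.QuantumFields.YangMills.Theorems.UnitScaleTiltProp7FlatSubsolutionMeanValue
import Literature.MathematicalPhysics.QuantumFieldTheory.Balaban1983to89.B4Eq19LatticeDirichletReplacement
import Literature.MathematicalPhysics.QuantumFieldTheory.Balaban1983to89.B4Eq19LatticeBoxMeans
import HarnessLib

/-!
# Line «poincare_lipschitz» on crux `HistoryTailL` (stmt-QuantumFields-19936), route crux `BlockLipschitzL` (stmt-QuantumFields-23533), K2 supplier plan,
# (R3)-COV brick (b) — THE COVARIANT DIRICHLET PROBLEM, HARMONIC REPLACEMENT AND HARMONIC MEAN VALUE ON A BOX OF `ℤ^d`, GENUINELY COVARIANT: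
# for a connection by LINEAR ISOMETRIES of a (finite-dimensional) real inner-product space, every right side `ψ` has a corrector `w` supported in
# `Q_r(z)` with `(Σ_μ D*_μD_μ + κ)w = ψ` on `Q_r(z)` (`κ ≥ 0`, massless included); for `ψ = Σ_μ D*_μ g_μ` its energy is `≤ Σ_{Q_{r+1}(z)} Σ_μ ‖g_μ‖²`;
# hence `u = h + w` with `h` covariantly `κ`-harmonic on the box; and the norm of a covariantly `κ`-harmonic `h` obeys the FLAT interior mean-value bound
# `‖h(x₀)‖² ≤ 16(336·d·2^d)^d·R^{−d}·Σ_{Q_R(x₀)} ‖h‖²` — NO smallness of the connection anywhere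

Cell `ym3-torus` (YM ladder rung R3 = continuum SU(2) Yang–Mills on the three-torus — a RUNG, NOT the Clay problem: not d = 4, not infinite volume, not a
mass gap); width seat `ym-ust-19936-w5` gen 11 (bus 2026-08-29T01:2xZ CLAIM «COV-DIRICHLET»; LEAD ym-ust-19936-w1 g7 card v1.29 (c): the K2 covariant road,
ONE convention, flat constants).  THEOREMS ONLY (def-free), in the letters of ✓`PoincareLipschitzCovariantCaccioppoli` (ym3-torus-px7 g4) VERBATIM;
`--supports stmt-QuantumFields-19936`.  Nothing here proves the (R3)-COV row, `hStab`, F5/F6, a stub, `BlockLipschitzL`, `HistoryTailL` or a summit statement.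

WHY (card v1.28 (c) / v1.29 (c); ★w5 g10 LOCATE-R3-COV §4).  F6 of the K2 supplier plan lands conditional on ONE displayed covariant interior-regularity row; its
concrete supplier is the covariant Campanato road = the flat road `B4Eq19Lattice*` ∕ `Prop7Flat*` redone with a metric connection: (a) covariant Caccioppoli
(✓`PoincareLipschitzCovariantCaccioppoli.cov_caccioppoli`), (b) harmonic replacement on a box + the mean value for the harmonic part + the sup bound for the
corrector, (e) the assembly `sup² ≲ R^{−d}·mass + R²·(sources)²` exactly as ✓`Prop7FlatSourcedMeanValue.sq_le_of_lop_eq_dvg`.  This file is (b) minus the corrector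
sup bound: the covariant twins of ✓`B4Eq19LatticeDirichletReplacement.exists_dirichlet`∕`dirichlet_energy_le`∕`exists_harmonic_replacement`, of
✓`B4Eq19LatticeDirichletZero.exists_dirichlet_zero` (massless), and — for the harmonic part — the lattice KATO inequality in these letters (px7's
✓`PoincareLipschitzCovariantKato` is the same fact in the `B9Eq39Adjoint` ring letters on the torus): the norm of a covariantly harmonic function is
flat-subharmonic, so ✓`Prop7FlatSubsolutionMeanValue.sq_le_of_subharmonic_nonneg` applies to `‖h‖` VERBATIM.  As for (a): no perturbation in the background —
injectivity of the box Dirichlet operator comes from the COVARIANT energy identity (zero energy ⇒ `h(y+e_0) = (τ 0 y)⁻¹h(y)` covariantly constant along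
`e_0`-lines from the zero boundary layer ⇒ `h = 0`; isometries are injective), and the energy bound is `Σ‖Dw‖² + κΣ‖w‖² = ΣΣ⟪D_μw, g_μ⟫ ≤ ‖Dw‖·‖g‖`.

SETTING (abstract; def-free, the operators are written out, letters of px7's file).  `V` a real inner-product space; a CONNECTION `τ : Fin d → ℤ^d → (V ≃ₗᵢ[ℝ] V)`,
`τ μ y` the transport from the fibre at `y + e_μ` to the fibre at `y`; covariant forward difference `D_μu(y) := τ μ y (u(y+e_μ)) − u(y)`; the operator
`(Σ_μ D*_μD_μ + κ)u (y) = Σ_μ ((u y + u y) − (τ μ (y−e_μ))⁻¹ u(y−e_μ) − τ μ y u(y+e_μ)) + κ·u(y)`; divergence-form data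
`(Σ_μ D*_μ g_μ)(y) = Σ_μ ((τ μ (y−e_μ))⁻¹ g_μ(y−e_μ) − g_μ(y))`.  INSTANCE OF RECORD (LEAD 01:03:24Z): `V = M_n(ℂ)` with the Frobenius real inner product
(✓`Prop7SectET3HilbertLetters.W₂`∕`frobEquiv`), `τ μ y = Ad(U_μ(y))` (✓`B9Eq39Adjoint.R`, unitary ⇒ isometry ✓`inner_adW_left`).

* §1 `covLop_sub`, `covLop_add`, `covLop_smul` (linearity in `u`); `covD_eq_zero_of_support`, `energy_le_of_support` (the energy of a function supported in
  `Q_r(z)` lives on `Q_{r+1}(z)`); ★ `energy_identity` (`Σ_{Q_R}⟪w, (ΣD*D+κ)w⟫ = Σ_{Q_R}Σ_μ‖D_μw‖² + κ·Σ_{Q_R}‖w‖²` for `w` vanishing off `Q_{R−1}(z)` — px7's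
  `sum_inner_covLop` at `φ = u = w`).
* §2 ★ `eq_zero_of_covD_eq_zero` — zero covariant `e_0`-difference on `Q_r(z)` and zero values off it force `w = 0` (covariant walk to the boundary layer).
* §3 ★★ `exists_cov_dirichlet` — `d ≥ 1`, `κ ≥ 0`, `V` finite-dimensional: `∃ w`, `w = 0` off `Q_r(z)`, `(ΣD*D+κ)w = ψ` on `Q_r(z)`.
* §4 ★★ `cov_dirichlet_energy_le` — `κ ≥ 0`, `w = 0` off `Q_r(z)`, `(ΣD*D+κ)w = ΣD*_μg_μ` on `Q_r(z)` ⇒ `Σ_{Q_{r+1}(z)}Σ_μ‖D_μw‖² ≤ Σ_{Q_{r+1}(z)}Σ_μ‖g_μ‖²`.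
* §5 ★★ `exists_cov_harmonic_replacement` — `(ΣD*D+κ)u = ΣD*_μg_μ` on `Q_r(z)` ⇒ `u = h + w`, `h` covariantly `κ`-harmonic on `Q_r(z)`, `w = 0` off the box,
  `Σ_QΣ_μ‖D_μw‖² ≤ Σ_{Q_{r+1}(z)}Σ_μ‖g_μ‖²` for EVERY finset `Q`.
* §6 ★ `lop_norm_nonpos_of_covHarmonic` (Kato: `‖h‖` is flat-subharmonic where `(ΣD*D+κ)h = 0`, `κ ≥ 0`), ★★ `normSq_le_of_covHarmonic` — `d ≥ 1`, `R ≥ 4`: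
  `(ΣD*D+κ)h = 0` on `Q_R(x₀)` ⇒ `‖h x₀‖² ≤ 16(336·d·2^d)^d·R^{−d}·Σ_{y ∈ Q_R(x₀)} ‖h y‖²`.
[folklore] ([Giaquinta1984] Ch. III §2 pp.77–79 with a metric connection; Kato's inequality on the lattice; [Balaban1984PropagatorsII] (1.9) p.226 and
[Balaban1985BackgroundPropagators] (3.3), (3.8), (3.23) pp.391–394 are the print loci of the flat constants and of the covariant letters).
-/

set_option autoImplicit false

noncomputable section

open scoped BigOperators InnerProductSpace
open Finset

namespace Summit.QuantumFields.YangMills.Theorems.PoincareLipschitzCovariantDirichlet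

open Literature.MathematicalPhysics.QuantumFieldTheory.Balaban1983to89
open B4Eq19LatticeOperators
open B4Eq19LatticeBoxMeans (update_succ_eq_add_unitVec)
open B4Eq19LatticeDirichletReplacement (sum_sum_mul_le_sqrt_mul_sqrt)
open Summit.QuantumFields.YangMills.Theorems.PoincareLipschitzCovariantCaccioppoli (sum_inner_covLop sum_inner_covDvg)
open Summit.QuantumFields.YangMills.Theorems.Prop7FlatSubsolutionMeanValue (sq_le_of_subharmonic_nonneg)

variable {d : ℕ} {V : Type*} [NormedAddCommGroup V] [InnerProductSpace ℝ V]

/-! ## §1 Linearity, support bookkeeping, and the covariant energy identity -/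

/-- `(ΣD*D+κ)` is additive in `u`. [folklore] [cite: Balaban1985BackgroundPropagators, (3.23) p.394] -/
theorem covLop_add (τ : Fin d → Zd d → (V ≃ₗᵢ[ℝ] V)) (κ : ℝ) (u v : Zd d → V) (y : Zd d) :
    (∑ μ, (((u y + v y) + (u y + v y)) - (τ μ (y - unitVec μ)).symm (u (y - unitVec μ) + v (y - unitVec μ)) -
        τ μ y (u (y + unitVec μ) + v (y + unitVec μ)))) + κ • (u y + v y) =
      ((∑ μ, ((u y + u y) - (τ μ (y - unitVec μ)).symm (u (y - unitVec μ)) - τ μ y (u (y + unitVec μ)))) + κ • u y) +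
        ((∑ μ, ((v y + v y) - (τ μ (y - unitVec μ)).symm (v (y - unitVec μ)) - τ μ y (v (y + unitVec μ)))) + κ • v y) := by
  have hpt : ∀ μ : Fin d, ((u y + v y) + (u y + v y)) - (τ μ (y - unitVec μ)).symm (u (y - unitVec μ) + v (y - unitVec μ)) -
      τ μ y (u (y + unitVec μ) + v (y + unitVec μ)) =
      ((u y + u y) - (τ μ (y - unitVec μ)).symm (u (y - unitVec μ)) - τ μ y (u (y + unitVec μ))) +
        ((v y + v y) - (τ μ (y - unitVec μ)).symm (v (y - unitVec μ)) - τ μ y (v (y + unitVec μ))) := fun μ => by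
    rw [map_add, map_add]; abel
  rw [Finset.sum_congr rfl fun μ _ => hpt μ, Finset.sum_add_distrib, smul_add]
  abel

/-- `(ΣD*D+κ)` is homogeneous in `u`. [folklore] [cite: Balaban1985BackgroundPropagators, (3.23) p.394] -/
theorem covLop_smul (τ : Fin d → Zd d → (V ≃ₗᵢ[ℝ] V)) (κ c : ℝ) (u : Zd d → V) (y : Zd d) :
    (∑ μ, ((c • u y + c • u y) - (τ μ (y - unitVec μ)).symm (c • u (y - unitVec μ)) - τ μ y (c • u (y + unitVec μ)))) + κ • (c • u y) =
      c • ((∑ μ, ((u y + u y) - (τ μ (y - unitVec μ)).symm (u (y - unitVec μ)) - τ μ y (u (y + unitVec μ)))) + κ • u y) := by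
  simp only [LinearIsometryEquiv.map_smul, smul_add, Finset.smul_sum, smul_sub, smul_comm c κ (u y)]

/-- `(ΣD*D+κ)` of a difference. [folklore] [cite: Balaban1985BackgroundPropagators, (3.23) p.394] -/
theorem covLop_sub (τ : Fin d → Zd d → (V ≃ₗᵢ[ℝ] V)) (κ : ℝ) (u w : Zd d → V) (y : Zd d) :
    (∑ μ, (((u y - w y) + (u y - w y)) - (τ μ (y - unitVec μ)).symm (u (y - unitVec μ) - w (y - unitVec μ)) -
        τ μ y (u (y + unitVec μ) - w (y + unitVec μ)))) + κ • (u y - w y) =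
      ((∑ μ, ((u y + u y) - (τ μ (y - unitVec μ)).symm (u (y - unitVec μ)) - τ μ y (u (y + unitVec μ)))) + κ • u y) -
        ((∑ μ, ((w y + w y) - (τ μ (y - unitVec μ)).symm (w (y - unitVec μ)) - τ μ y (w (y + unitVec μ)))) + κ • w y) := by
  have hpt : ∀ μ : Fin d, ((u y - w y) + (u y - w y)) - (τ μ (y - unitVec μ)).symm (u (y - unitVec μ) - w (y - unitVec μ)) -
      τ μ y (u (y + unitVec μ) - w (y + unitVec μ)) =
      ((u y + u y) - (τ μ (y - unitVec μ)).symm (u (y - unitVec μ)) - τ μ y (u (y + unitVec μ))) -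
        ((w y + w y) - (τ μ (y - unitVec μ)).symm (w (y - unitVec μ)) - τ μ y (w (y + unitVec μ))) := fun μ => by
    rw [map_sub, map_sub]; abel
  rw [Finset.sum_congr rfl fun μ _ => hpt μ, Finset.sum_sub_distrib, smul_sub]
  abel

/-- The covariant forward differences of a function vanishing off `Q_r(z)` vanish off `Q_{r+1}(z)`. [folklore] [cite: Giaquinta1984, Ch. III §2 p.78] -/
theorem covD_eq_zero_of_support (τ : Fin d → Zd d → (V ≃ₗᵢ[ℝ] V)) {w : Zd d → V} {z : Zd d} {r : ℤ} (hw0 : ∀ y ∉ box z r, w y = 0) {y : Zd d}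
    (hy : y ∉ box z (r + 1)) (μ : Fin d) : τ μ y (w (y + unitVec μ)) - w y = 0 := by
  rw [hw0 y fun h => hy (box_mono z (by linarith) h), hw0 _ (add_unitVec_not_mem_box hy μ), map_zero, sub_zero]

/-- **The energy of a function supported in `Q_r(z)` lives on `Q_{r+1}(z)`**: `Σ_QΣ_μ‖D_μw‖² ≤ Σ_{Q_{r+1}(z)}Σ_μ‖D_μw‖²` for every finset `Q`.
[folklore] [cite: Giaquinta1984, Ch. III §2 p.78] -/
theorem energy_le_of_support (τ : Fin d → Zd d → (V ≃ₗᵢ[ℝ] V)) {w : Zd d → V} {z : Zd d} {r : ℤ} (hw0 : ∀ y ∉ box z r, w y = 0) (Q : Finset (Zd d)) :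
    ∑ y ∈ Q, ∑ μ, ‖τ μ y (w (y + unitVec μ)) - w y‖ ^ 2 ≤ ∑ y ∈ box z (r + 1), ∑ μ, ‖τ μ y (w (y + unitVec μ)) - w y‖ ^ 2 := by
  classical
  have h1 : ∑ y ∈ Q ∩ box z (r + 1), ∑ μ, ‖τ μ y (w (y + unitVec μ)) - w y‖ ^ 2 = ∑ y ∈ Q, ∑ μ, ‖τ μ y (w (y + unitVec μ)) - w y‖ ^ 2 := by
    apply Finset.sum_subset Finset.inter_subset_left
    intro y hyQ hy
    have hy' : y ∉ box z (r + 1) := fun h => hy (Finset.mem_inter.2 ⟨hyQ, h⟩)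
    exact Finset.sum_eq_zero fun μ _ => by rw [covD_eq_zero_of_support τ hw0 hy' μ]; simp
  rw [← h1]
  exact Finset.sum_le_sum_of_subset_of_nonneg Finset.inter_subset_right fun _ _ _ => Finset.sum_nonneg fun _ _ => sq_nonneg _

/-- ★ **THE COVARIANT ENERGY IDENTITY**: for `w` vanishing off `Q_{R−1}(z)`,
`Σ_{Q_R}⟪w, (ΣD*D+κ)w⟫ = Σ_{Q_R}Σ_μ‖D_μw‖² + κ·Σ_{Q_R}‖w‖²` (isometric transports ⇒ `D*` is the exact adjoint of `D`). [folklore]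
[cite: Balaban1985BackgroundPropagators, (3.8), (3.23) pp.392-394] -/
theorem energy_identity (τ : Fin d → Zd d → (V ≃ₗᵢ[ℝ] V)) (κ : ℝ) (w : Zd d → V) (z : Zd d) (R : ℤ) (hw : ∀ y ∉ box z (R - 1), w y = 0) :
    ∑ y ∈ box z R, ⟪w y, (∑ μ, ((w y + w y) - (τ μ (y - unitVec μ)).symm (w (y - unitVec μ)) - τ μ y (w (y + unitVec μ)))) + κ • w y⟫_ℝ =
      (∑ y ∈ box z R, ∑ μ, ‖τ μ y (w (y + unitVec μ)) - w y‖ ^ 2) + κ * ∑ y ∈ box z R, ‖w y‖ ^ 2 := by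
  rw [sum_inner_covLop τ κ w w z R hw]
  simp only [real_inner_self_eq_norm_sq]

/-! ## §2 Zero covariant `e_0`-energy on the box and zero values off it force zero values -/

/-- ★ **COVARIANT WALK TO THE BOUNDARY LAYER**: if `w = 0` off `Q_r(z)` and `D_0w = 0` on `Q_r(z)` (`τ 0 y (w(y+e_0)) = w(y)`), then `w = 0` everywhere
(`w(y) = τ 0 y (w(y+e_0)) = … ` is a transport of the zero value at the first exit point of the `e_0`-line from the box). [folklore]
[cite: Giaquinta1984, Ch. III §2 p.78] -/
theorem eq_zero_of_covD_eq_zero (hd : 0 < d) (τ : Fin d → Zd d → (V ≃ₗᵢ[ℝ] V)) {w : Zd d → V} {z : Zd d} {r : ℤ} (hw0 : ∀ y ∉ box z r, w y = 0)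
    (hD : ∀ y ∈ box z r, τ ⟨0, hd⟩ y (w (y + unitVec ⟨0, hd⟩)) - w y = 0) : ∀ y, w y = 0 := by
  set j₀ : Fin d := ⟨0, hd⟩
  intro x
  by_cases hx : x ∈ box z r
  · have hxi := mem_box.1 hx
    -- backward induction along the `e_0`-line: if the value `n` steps ahead vanishes, so does `w x`
    have walk : ∀ n : ℕ, x j₀ + n ≤ z j₀ + r + 1 → w (Function.update x j₀ (x j₀ + n)) = 0 → w x = 0 := by
      intro n
      induction n with
      | zero => intro _ h; simpa using h
      | succ n ih =>
        intro hn hzero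
        have hn' : x j₀ + n ≤ z j₀ + r := by push_cast at hn; linarith
        have hmem : Function.update x j₀ (x j₀ + n) ∈ box z r := by
          rw [mem_box]; intro i
          by_cases h : i = j₀
          · rw [h]; simp only [Function.update_self]
            have := hxi j₀; rw [abs_le] at this ⊢; constructor <;> [linarith; linarith]
          · rw [Function.update_of_ne h]; exact hxi i
        have h0 := hD _ hmem
        rw [← update_succ_eq_add_unitVec] at h0
        have hz' : w (Function.update x j₀ (x j₀ + n + 1)) = 0 := by
          have : (x j₀ + ((n + 1 : ℕ) : ℤ)) = x j₀ + n + 1 := by push_cast; ring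
          rw [this] at hzero; exact hzero
        rw [hz', map_zero, zero_sub, neg_eq_zero] at h0
        exact ih (by linarith) h0
    obtain ⟨N, hN⟩ : ∃ N : ℕ, x j₀ + N = z j₀ + r + 1 :=
      ⟨(z j₀ + r + 1 - x j₀).toNat, by
        rw [Int.toNat_of_nonneg (by have := hxi j₀; rw [abs_le] at this; linarith)]; ring⟩
    have hout : Function.update x j₀ (x j₀ + N) ∉ box z r := by
      rw [mem_box]; push Not; refine ⟨j₀, ?_⟩
      simp only [Function.update_self, hN]
      rw [show z j₀ + r + 1 - z j₀ = r + 1 by ring, abs_of_nonneg (by have := hxi j₀; have := abs_nonneg (x j₀ - z j₀); linarith)]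
      linarith
    exact walk N hN.le (hw0 _ hout)
  · exact hw0 x hx

/-! ## §3 The covariant Dirichlet problem on a box (`κ ≥ 0`, massless included) -/

/-- ★★ **THE COVARIANT DIRICHLET PROBLEM ON A BOX**: `d ≥ 1`, `κ ≥ 0`, `V` finite-dimensional; every `ψ : ℤ^d → V` has a `w` with `w = 0` off `Q_r(z)` and
`(Σ_μD*_μD_μ + κ)w = ψ` on `Q_r(z)` (the linear map `v ↦ ((ΣD*D+κ)(ext v))|_{Q_r(z)}` on `Q_r(z) → V` is injective by the covariant energy identity — zero
energy ⇒ zero covariant `e_0`-differences ⇒ `v = 0` by §2 — hence bijective).  NO hypothesis on the connection. [folklore]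
[cite: Giaquinta1984, Ch. III §2 p.78; Balaban1985BackgroundPropagators, (3.23) p.394] -/
theorem exists_cov_dirichlet [FiniteDimensional ℝ V] (hd : 0 < d) (τ : Fin d → Zd d → (V ≃ₗᵢ[ℝ] V)) {κ : ℝ} (hκ : 0 ≤ κ) (z : Zd d) (r : ℤ)
    (ψ : Zd d → V) :
    ∃ w : Zd d → V, (∀ y ∉ box z r, w y = 0) ∧
      ∀ y ∈ box z r, (∑ μ, ((w y + w y) - (τ μ (y - unitVec μ)).symm (w (y - unitVec μ)) - τ μ y (w (y + unitVec μ)))) + κ • w y = ψ y := by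
  classical
  set S : Finset (Zd d) := box z r with hS
  -- extension by zero, as a linear map
  let ext : (S → V) →ₗ[ℝ] (Zd d → V) :=
    { toFun := fun v y => if h : y ∈ S then v ⟨y, h⟩ else 0
      map_add' := fun v v' => by
        funext y; by_cases h : y ∈ S <;> simp [h]
      map_smul' := fun c v => by
        funext y; by_cases h : y ∈ S <;> simp [h] }
  have ext_apply_mem : ∀ (v : S → V) (y : Zd d) (h : y ∈ S), ext v y = v ⟨y, h⟩ := fun v y h => by
    simp [ext, h]
  have ext_apply_not_mem : ∀ (v : S → V) (y : Zd d), y ∉ S → ext v y = 0 := fun v y h => by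
    simp [ext, h]
  -- the covariant Dirichlet operator
  let T : (S → V) →ₗ[ℝ] (S → V) :=
    { toFun := fun v x =>
        (∑ μ, ((ext v x + ext v x) - (τ μ ((x : Zd d) - unitVec μ)).symm (ext v ((x : Zd d) - unitVec μ)) -
          τ μ x (ext v ((x : Zd d) + unitVec μ)))) + κ • ext v x
      map_add' := fun v v' => by
        funext x
        have e : ∀ y, ext (v + v') y = ext v y + ext v' y := fun y => by rw [map_add]; rfl
        simp only [e, Pi.add_apply]
        exact covLop_add τ κ (ext v) (ext v') x
      map_smul' := fun c v => by
        funext x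
        have e : ∀ y, ext (c • v) y = c • ext v y := fun y => by rw [map_smul]; rfl
        simp only [e, Pi.smul_apply, RingHom.id_apply]
        exact covLop_smul τ κ c (ext v) x }
  have T_apply : ∀ (v : S → V) (x : S), T v x =
      (∑ μ, ((ext v x + ext v x) - (τ μ ((x : Zd d) - unitVec μ)).symm (ext v ((x : Zd d) - unitVec μ)) -
        τ μ x (ext v ((x : Zd d) + unitVec μ)))) + κ • ext v x := fun v x => rfl
  -- injectivity from the covariant energy identity
  have hinj : Function.Injective T := by
    rw [← LinearMap.ker_eq_bot, LinearMap.ker_eq_bot']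
    intro v hv
    have hsupp : ∀ y ∉ box z (r + 1 - 1), ext v y = 0 := fun y hy => ext_apply_not_mem v y (by rwa [show r + 1 - 1 = r by ring] at hy)
    have hE := energy_identity τ κ (ext v) z (r + 1) hsupp
    have hzero : ∑ y ∈ box z (r + 1), ⟪ext v y, (∑ μ, ((ext v y + ext v y) - (τ μ (y - unitVec μ)).symm (ext v (y - unitVec μ)) -
        τ μ y (ext v (y + unitVec μ)))) + κ • ext v y⟫_ℝ = 0 := by
      refine Finset.sum_eq_zero fun y _ => ?_
      by_cases hy : y ∈ S
      · have : (∑ μ, ((ext v y + ext v y) - (τ μ (y - unitVec μ)).symm (ext v (y - unitVec μ)) - τ μ y (ext v (y + unitVec μ)))) + κ • ext v y =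
            T v ⟨y, hy⟩ := rfl
        rw [this, hv]; simp
      · rw [ext_apply_not_mem v y hy, inner_zero_left]
    set E := ∑ y ∈ box z (r + 1), ∑ μ, ‖τ μ y (ext v (y + unitVec μ)) - ext v y‖ ^ 2 with hEdef
    have hE0 : 0 ≤ E := Finset.sum_nonneg fun _ _ => Finset.sum_nonneg fun _ _ => sq_nonneg _
    have hM0 : 0 ≤ κ * ∑ y ∈ box z (r + 1), ‖ext v y‖ ^ 2 := mul_nonneg hκ (Finset.sum_nonneg fun _ _ => sq_nonneg _)
    have hEz : E = 0 := by
      rw [hzero] at hE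
      linarith
    have hD0 : ∀ y ∈ box z r, τ ⟨0, hd⟩ y (ext v (y + unitVec ⟨0, hd⟩)) - ext v y = 0 := by
      intro y hy
      have hy' : y ∈ box z (r + 1) := box_mono z (by linarith) hy
      have h1 := (Finset.sum_eq_zero_iff_of_nonneg fun y _ =>
        Finset.sum_nonneg fun μ _ => sq_nonneg ‖τ μ y (ext v (y + unitVec μ)) - ext v y‖).1 hEz y hy'
      have h2 := (Finset.sum_eq_zero_iff_of_nonneg fun μ _ => sq_nonneg ‖τ μ y (ext v (y + unitVec μ)) - ext v y‖).1 h1 ⟨0, hd⟩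
        (Finset.mem_univ _)
      have h3 : ‖τ ⟨0, hd⟩ y (ext v (y + unitVec ⟨0, hd⟩)) - ext v y‖ = 0 := pow_eq_zero_iff (n := 2) (by norm_num) |>.1 h2
      exact norm_eq_zero.1 h3
    have hall := eq_zero_of_covD_eq_zero hd τ (fun y hy => ext_apply_not_mem v y (by simpa [hS] using hy)) hD0
    funext x
    have := hall x
    rw [ext_apply_mem v x x.2] at this
    simpa using this
  have hsurj : Function.Surjective T := LinearMap.surjective_of_injective hinj
  obtain ⟨v, hv⟩ := hsurj fun x => ψ x
  refine ⟨ext v, fun y hy => ext_apply_not_mem v y (by simpa [hS] using hy), fun y hy => ?_⟩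
  have : T v ⟨y, by simpa [hS] using hy⟩ = ψ y := by rw [hv]
  rw [T_apply] at this
  exact this

/-! ## §4 The energy bound of the corrector -/

/-- ★★ **THE ENERGY BOUND**: for `κ ≥ 0`, if `w = 0` off `Q_r(z)` and `(ΣD*D+κ)w = Σ_μD*_μg_μ` on `Q_r(z)`, then
`Σ_{Q_{r+1}(z)}Σ_μ‖D_μw‖² ≤ Σ_{Q_{r+1}(z)}Σ_μ‖g_μ‖²` (`Σ‖Dw‖² + κΣ‖w‖² = Σ⟪w, ΣD*g⟫ = ΣΣ⟪D_μw, g_μ⟫ ≤ ‖Dw‖·‖g‖`).  NO hypothesis on the connection. [folklore]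
[cite: Giaquinta1984, Ch. III §2 (2.8) p.79; Balaban1985BackgroundPropagators, (3.8) p.392] -/
theorem cov_dirichlet_energy_le (τ : Fin d → Zd d → (V ≃ₗᵢ[ℝ] V)) {κ : ℝ} (hκ : 0 ≤ κ) {w : Zd d → V} {z : Zd d} {r : ℤ} (g : Zd d → Fin d → V)
    (hw0 : ∀ y ∉ box z r, w y = 0)
    (hw : ∀ y ∈ box z r, (∑ μ, ((w y + w y) - (τ μ (y - unitVec μ)).symm (w (y - unitVec μ)) - τ μ y (w (y + unitVec μ)))) + κ • w y =
      ∑ μ, ((τ μ (y - unitVec μ)).symm (g (y - unitVec μ) μ) - g y μ)) :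
    ∑ y ∈ box z (r + 1), ∑ μ, ‖τ μ y (w (y + unitVec μ)) - w y‖ ^ 2 ≤ ∑ y ∈ box z (r + 1), ∑ μ, ‖g y μ‖ ^ 2 := by
  classical
  have hsupp : ∀ y ∉ box z (r + 1 - 1), w y = 0 := fun y hy => hw0 y (by simpa using hy)
  have hE := energy_identity τ κ w z (r + 1) hsupp
  have hDv := sum_inner_covDvg τ w g z (r + 1) hsupp
  have hEq' : ∑ y ∈ box z (r + 1), ⟪w y, (∑ μ, ((w y + w y) - (τ μ (y - unitVec μ)).symm (w (y - unitVec μ)) - τ μ y (w (y + unitVec μ)))) + κ • w y⟫_ℝ =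
      ∑ y ∈ box z (r + 1), ⟪w y, ∑ μ, ((τ μ (y - unitVec μ)).symm (g (y - unitVec μ) μ) - g y μ)⟫_ℝ := by
    refine Finset.sum_congr rfl fun y _ => ?_
    by_cases hy : y ∈ box z r
    · rw [hw y hy]
    · rw [hw0 y hy, inner_zero_left, inner_zero_left]
  set E := ∑ y ∈ box z (r + 1), ∑ μ, ‖τ μ y (w (y + unitVec μ)) - w y‖ ^ 2 with hEdef
  set G := ∑ y ∈ box z (r + 1), ∑ μ, ‖g y μ‖ ^ 2 with hGdef
  have hE0 : 0 ≤ E := Finset.sum_nonneg fun _ _ => Finset.sum_nonneg fun _ _ => sq_nonneg _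
  have hG0 : 0 ≤ G := Finset.sum_nonneg fun _ _ => Finset.sum_nonneg fun _ _ => sq_nonneg _
  have hmass : 0 ≤ κ * ∑ y ∈ box z (r + 1), ‖w y‖ ^ 2 := mul_nonneg hκ (Finset.sum_nonneg fun _ _ => sq_nonneg _)
  have hCS : ∑ y ∈ box z (r + 1), ∑ μ, ⟪τ μ y (w (y + unitVec μ)) - w y, g y μ⟫_ℝ ≤ Real.sqrt E * Real.sqrt G := by
    have h1 : ∑ y ∈ box z (r + 1), ∑ μ, ⟪τ μ y (w (y + unitVec μ)) - w y, g y μ⟫_ℝ ≤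
        ∑ y ∈ box z (r + 1), ∑ μ, ‖τ μ y (w (y + unitVec μ)) - w y‖ * ‖g y μ‖ :=
      Finset.sum_le_sum fun y _ => Finset.sum_le_sum fun μ _ => real_inner_le_norm _ _
    have h2 := sum_sum_mul_le_sqrt_mul_sqrt (box z (r + 1)) (fun y μ => ‖τ μ y (w (y + unitVec μ)) - w y‖) (fun y μ => ‖g y μ‖)
    exact h1.trans h2
  have h1 : E ≤ Real.sqrt E * Real.sqrt G := by
    have : E + κ * ∑ y ∈ box z (r + 1), ‖w y‖ ^ 2 = ∑ y ∈ box z (r + 1), ∑ μ, ⟪τ μ y (w (y + unitVec μ)) - w y, g y μ⟫_ℝ := by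
      rw [← hE, hEq', hDv]
    linarith
  -- `E ≤ √E √G` ⟹ `E ≤ G`
  have h2 : Real.sqrt E * Real.sqrt E ≤ Real.sqrt E * Real.sqrt G := by rwa [Real.mul_self_sqrt hE0]
  by_cases hE' : Real.sqrt E = 0
  · have : E = 0 := by rwa [Real.sqrt_eq_zero hE0] at hE'
    rw [this]; exact hG0
  · have hpos : 0 < Real.sqrt E := lt_of_le_of_ne (Real.sqrt_nonneg _) (Ne.symm hE')
    have h3 : Real.sqrt E ≤ Real.sqrt G := le_of_mul_le_mul_left h2 hpos
    rw [Real.sqrt_le_sqrt_iff hG0] at h3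
    exact h3

/-! ## §5 The covariant harmonic replacement packaged -/

/-- ★★ **COVARIANT HARMONIC REPLACEMENT ON A BOX.**  `d ≥ 1`, `κ ≥ 0`, `V` finite-dimensional; for `(ΣD*D+κ)u = Σ_μD*_μg_μ` on `Q_r(z)` there are `h`, `w`
with `u = h + w` everywhere, `w = 0` off `Q_r(z)`, `h` covariantly `κ`-harmonic on `Q_r(z)` (`(ΣD*D+κ)h = 0` there), and
`Σ_QΣ_μ‖D_μw‖² ≤ Σ_{y ∈ Q_{r+1}(z)}Σ_μ‖g_μ(y)‖²` for EVERY finset `Q`.  NO hypothesis on the connection. [folklore]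
[cite: Giaquinta1984, Ch. III §2 pp.78–79; Balaban1984PropagatorsII, (1.9) p.226] -/
theorem exists_cov_harmonic_replacement [FiniteDimensional ℝ V] (hd : 0 < d) (τ : Fin d → Zd d → (V ≃ₗᵢ[ℝ] V)) {κ : ℝ} (hκ : 0 ≤ κ)
    (u : Zd d → V) (g : Zd d → Fin d → V) (z : Zd d) (r : ℤ)
    (hEq : ∀ y ∈ box z r, (∑ μ, ((u y + u y) - (τ μ (y - unitVec μ)).symm (u (y - unitVec μ)) - τ μ y (u (y + unitVec μ)))) + κ • u y =
      ∑ μ, ((τ μ (y - unitVec μ)).symm (g (y - unitVec μ) μ) - g y μ)) :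
    ∃ h w : Zd d → V, (∀ y, u y = h y + w y) ∧ (∀ y ∉ box z r, w y = 0) ∧
      (∀ y ∈ box z r, (∑ μ, ((h y + h y) - (τ μ (y - unitVec μ)).symm (h (y - unitVec μ)) - τ μ y (h (y + unitVec μ)))) + κ • h y = 0) ∧
      (∀ Q : Finset (Zd d), ∑ y ∈ Q, ∑ μ, ‖τ μ y (w (y + unitVec μ)) - w y‖ ^ 2 ≤ ∑ y ∈ box z (r + 1), ∑ μ, ‖g y μ‖ ^ 2) := by
  obtain ⟨w, hw0, hw⟩ := exists_cov_dirichlet hd τ hκ z r (fun y => ∑ μ, ((τ μ (y - unitVec μ)).symm (g (y - unitVec μ) μ) - g y μ))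
  refine ⟨fun y => u y - w y, w, fun y => by simp, hw0, fun y hy => ?_, fun Q => ?_⟩
  · rw [covLop_sub τ κ u w y, hEq y hy, hw y hy, sub_self]
  · exact (energy_le_of_support τ hw0 Q).trans (cov_dirichlet_energy_le τ hκ g hw0 hw)

/-! ## §6 Kato: the norm of a covariantly harmonic function is flat-subharmonic; the covariant interior mean-value bound -/

/-- ★ **KATO, POINTWISE, IN THESE LETTERS**: if `(ΣD*D+κ)h = 0` at `y` with `κ ≥ 0`, then `lop 0 ‖h‖ (y) ≤ 0`, i.e.
`2d·‖h y‖ ≤ Σ_μ (‖h(y+e_μ)‖ + ‖h(y−e_μ)‖)` (`(2d+κ)h(y) = Σ_μ (τ⁻¹h(y−e_μ) + τh(y+e_μ))` EXACTLY; the transports are isometries).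
[folklore] [cite: Balaban1985BackgroundPropagators, (3.3), (3.8) pp.391-392] -/
theorem lop_norm_nonpos_of_covHarmonic (τ : Fin d → Zd d → (V ≃ₗᵢ[ℝ] V)) {κ : ℝ} (hκ : 0 ≤ κ) (h : Zd d → V) {y : Zd d}
    (hh : (∑ μ, ((h y + h y) - (τ μ (y - unitVec μ)).symm (h (y - unitVec μ)) - τ μ y (h (y + unitVec μ)))) + κ • h y = 0) :
    lop 0 (fun x => ‖h x‖) y ≤ 0 := by
  -- the exact identity `(2d+κ) • h y = Σ_μ (transported neighbours)`
  set N : V := ∑ μ, ((τ μ (y - unitVec μ)).symm (h (y - unitVec μ)) + τ μ y (h (y + unitVec μ))) with hN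
  have hexp : ((2 * (d : ℝ) + κ)) • h y = N := by
    have e1 : (∑ μ : Fin d, ((h y + h y) - (τ μ (y - unitVec μ)).symm (h (y - unitVec μ)) - τ μ y (h (y + unitVec μ)))) =
        (2 * (d : ℝ)) • h y - N := by
      rw [hN]
      have : ∀ μ : Fin d, (h y + h y) - (τ μ (y - unitVec μ)).symm (h (y - unitVec μ)) - τ μ y (h (y + unitVec μ)) =
          (h y + h y) - ((τ μ (y - unitVec μ)).symm (h (y - unitVec μ)) + τ μ y (h (y + unitVec μ))) := fun μ => by abel
      rw [Finset.sum_congr rfl fun μ _ => this μ, Finset.sum_sub_distrib, Finset.sum_const, Finset.card_univ, Fintype.card_fin]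
      congr 1
      rw [← two_smul ℝ (h y), ← Nat.cast_smul_eq_nsmul ℝ d, smul_smul, mul_comm]
    rw [e1] at hh
    rw [add_smul]
    rw [sub_add_eq_add_sub, sub_eq_zero] at hh
    exact hh
  have hnb : ‖N‖ ≤ ∑ μ, (‖h (y + unitVec μ)‖ + ‖h (y - unitVec μ)‖) := by
    rw [hN]
    refine (norm_sum_le _ _).trans (Finset.sum_le_sum fun μ _ => (norm_add_le _ _).trans ?_)
    rw [LinearIsometryEquiv.norm_map, LinearIsometryEquiv.norm_map, add_comm]
  have hsm : ‖((2 * (d : ℝ) + κ)) • h y‖ = (2 * (d : ℝ) + κ) * ‖h y‖ := by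
    rw [norm_smul, Real.norm_of_nonneg (by positivity)]
  have hmain : (2 * (d : ℝ) + κ) * ‖h y‖ ≤ ∑ μ, (‖h (y + unitVec μ)‖ + ‖h (y - unitVec μ)‖) := by
    rw [← hsm, hexp]; exact hnb
  have hlap : lop 0 (fun x => ‖h x‖) y = 2 * (d : ℝ) * ‖h y‖ - ∑ μ, (‖h (y + unitVec μ)‖ + ‖h (y - unitVec μ)‖) := by
    rw [lop_apply]
    simp only [zero_mul, add_zero]
    have : ∀ μ : Fin d, 2 * ‖h y‖ - ‖h (y + unitVec μ)‖ - ‖h (y - unitVec μ)‖ = 2 * ‖h y‖ - (‖h (y + unitVec μ)‖ + ‖h (y - unitVec μ)‖) :=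
      fun μ => by ring
    simp only [this, Finset.sum_sub_distrib, Finset.sum_const, Finset.card_univ, Fintype.card_fin, nsmul_eq_mul]
    ring
  have hk : 0 ≤ κ * ‖h y‖ := mul_nonneg hκ (norm_nonneg _)
  rw [hlap]
  nlinarith

/-- ★★ **THE COVARIANT INTERIOR MEAN-VALUE BOUND, FLAT CONSTANTS**: `d ≥ 1`, `R ≥ 4`, `κ ≥ 0`; if `(ΣD*D+κ)h = 0` on `Q_R(x₀)`, then
`‖h x₀‖² ≤ 16(336·d·2^d)^d·R^{−d}·Σ_{y ∈ Q_R(x₀)} ‖h y‖²` — ✓`Prop7FlatSubsolutionMeanValue.sq_le_of_subharmonic_nonneg` applied to the flat-subharmonic `‖h‖`;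
NO hypothesis on the connection. [folklore] [cite: Balaban1984PropagatorsII, (1.9) p.226] -/
theorem normSq_le_of_covHarmonic (hd : 1 ≤ d) (τ : Fin d → Zd d → (V ≃ₗᵢ[ℝ] V)) {κ : ℝ} (hκ : 0 ≤ κ) (h : Zd d → V) (x₀ : Zd d) {R : ℤ}
    (hR : 4 ≤ R)
    (hh : ∀ y ∈ box x₀ R, (∑ μ, ((h y + h y) - (τ μ (y - unitVec μ)).symm (h (y - unitVec μ)) - τ μ y (h (y + unitVec μ)))) + κ • h y = 0) :
    ‖h x₀‖ ^ 2 ≤ 16 * (336 * (d : ℝ) * (2 : ℝ) ^ d) ^ d / (R : ℝ) ^ d * ∑ y ∈ box x₀ R, ‖h y‖ ^ 2 :=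
  sq_le_of_subharmonic_nonneg hd (fun x => ‖h x‖) (fun _ => norm_nonneg _) x₀ hR
    (fun y hy => lop_norm_nonpos_of_covHarmonic τ hκ h (hh y hy))

end Summit.QuantumFields.YangMills.Theorems.PoincareLipschitzCovariantDirichlet

end
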